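import Summits.CriticalPhenomena.Ising3DConformalLimit.Theorems.EnergyNotSigmaSquaredGapForcesFarMergingRPSchwarzDefs
import Summits.CriticalPhenomena.Ising3DConformalLimit.Theorems.EnergyNotSigmaSquaredGapForcesFarMergingUnpinchedEnvelope
import Literature.Probability.LatticeModels.SharpnessProofs
import HarnessLib

/-!
# Stub B of the line `rp-schwarz-single-pinch`: GAP and the RP Gram minor give the one-pinch law
(crux `GapForcesFarMerging`, item stmt-CriticalPhenomena-4468, route `EnergyNotSigmaSquared`;
registered stub `stub_gapGivesOnePinchLaw : RPSchwarzOnePinch → EnergyGapPowerLaw → OnePinchLaw`)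

Fix `t ≥ 1` and two targets `p, q` in the plane `{y₀ = 0}`. The mirror `θ_t : y₀ ↦ t - y₀` maps
them to `θ_t p = te₁ + p`, `θ_t q = te₁ + q` (`axisRefl_inplane`), so the Gram minor
`RPSchwarzOnePinch` at `(t, p, q)` reads `X² ≤ E · P` with
* `X = ⟨σ₀σ_{e₂} ; σ_{te₁+p}σ_{te₁+q}⟩` (the quantity of `OnePinchLaw`),
* `E = ⟨σ₀σ_{e₂} ; σ_{te₁}σ_{te₁+e₂}⟩ ≤ max(C,0) · t^{-κ} · G(te₁)²` — `EnergyGapPowerLaw` at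
  `x = te₁`, `‖te₁‖ = t` (sup norm),
* `P = ⟨σ_pσ_q ; σ_{te₁+p}σ_{te₁+q}⟩ ≤ G(te₁)² + G(te₁+q-p)·G(te₁+p-q) ≤ 2 G(te₁)²` — Lebowitz'
  inequality (`pairPairTruncation_le_pairings`) and the TRANSVERSE Messager–Miracle-Solé bound
  `G(z) ≤ G(z₀ e₁)` (`criticalTwoPoint_le_far_axis`: reflect the coordinates of `z` to their absolute
  values, `twoPointPlus_abs_eq`, then zero the transverse ones, `twoPointPlus_le_single_of_nonneg`),
and `E, P ≥ 0` by GKS II (`pairPairTruncation_nonneg`). Hence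
`X ≤ |X| ≤ √(E·P) ≤ √(2 max(C,0)) · t^{-κ/2} · G(te₁)²`: the one-pinch law with exponent `κ/2`
(the `rpow`/`sqrt` algebra is that of `singlePinchLaw_of_gap_and_isoRP` in
`Theorems/GapForcesFarMerging/Negative/ScaleIterationDyadic.lean`, which is the isosceles case).

References: J. Fröhlich, R. Israel, E. H. Lieb, B. Simon, Comm. Math. Phys. 62 (1978) 1–34, Thm. 2.1
[FILS1978]; J. L. Lebowitz, Comm. Math. Phys. 35 (1974) 87–92, eq. (2.5b) [Lebowitz1974];
A. Messager, S. Miracle-Solé, J. Stat. Phys. 17 (1977) 245–262 [MessagerMiracleSoleJSP1977].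
-/

noncomputable section

namespace Summit.CriticalPhenomena.Ising3DConformalLimit.GapForcesFarMergingRPSchwarz

open Literature.Probability.LatticeModels
open Summit.CriticalPhenomena.Ising3DConformalLimit.Theses.EnergyNotSigmaSquared
open Summit.CriticalPhenomena.Ising3DConformalLimit.Theorems.GapForcesFarMerging.Negative (e₁ e₂ cc2)
open Summit.CriticalPhenomena.Ising3DConformalLimit.EnergyNotSigmaSquaredGapForcesFarMerging
  (pairPairTruncation_nonneg pairPairTruncation_le_pairings)

/-! ### Lattice geometry of the far plane -/

/-- In-plane points are mirrored onto the far plane by a shift: `θ_t p = te₁ + p` for `p₀ = 0`.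
[folklore] -/
theorem axisRefl_inplane (t : ℕ) (p : Site 3) (hp : p 0 = 0) :
    axisRefl 0 (t : ℤ) p = (t : ℤ) • e₁ + p := by
  ext j
  fin_cases j <;> simp [axisRefl_apply, e₁, hp]

/-- `te₁ = Pi.single 0 t`. [folklore] -/
theorem natSmul_e₁ (t : ℕ) : ((t : ℤ) • e₁ : Site 3) = Pi.single 0 (t : ℤ) := by
  ext j
  fin_cases j <;> simp [e₁]

/-- `‖te₁‖ = t` (sup norm). [folklore] -/
theorem norm_natSmul_e₁ (t : ℕ) : ‖((t : ℤ) • e₁ : Site 3)‖ = t := by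
  rw [natSmul_e₁, Pi.norm_single]
  simp

/-- `te₁ ≠ 0` for `t ≥ 1`. [folklore] -/
theorem natSmul_e₁_ne_zero (t : ℕ) (ht : 1 ≤ t) : ((t : ℤ) • e₁ : Site 3) ≠ 0 := by
  intro h
  have := congrFun h 0
  simp [e₁] at this
  omega

/-! ### Transverse Messager–Miracle-Solé -/

/-- **Transverse Messager–Miracle-Solé** at `β_c` on `ℤ³`: if `z₀ = t ≥ 0` then `G(z) ≤ G(te₁)` —
reflect every coordinate to its absolute value (reflection invariance of the critical two-point
function) and zero the transverse coordinates one unit step at a time (Messager–Miracle-Solé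
monotonicity). [cite: MessagerMiracleSoleJSP1977, main theorem (monotonicity of ⟨σ₀σ_x⟩ under reflections)] -/
theorem criticalTwoPoint_le_far_axis (z : Site 3) (t : ℕ) (hz : z 0 = t) :
    criticalTwoPoint 3 z ≤ criticalTwoPoint 3 ((t : ℤ) • e₁) := by
  have h1 : twoPointPlus 3 (criticalBeta 3) (fun i => |z i|) = twoPointPlus 3 (criticalBeta 3) z :=
    twoPointPlus_abs_eq (d := 3) twoPointPlus_reflection_invariant_holds (criticalBeta_nonneg 3) z
  have h2 : twoPointPlus 3 (criticalBeta 3) (fun i => |z i|) ≤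
      twoPointPlus 3 (criticalBeta 3) (Pi.single 0 |z 0|) :=
    twoPointPlus_le_single_of_nonneg (d := 3) messager_miracleSole_holds (criticalBeta_nonneg 3)
      (fun i => |z i|) (fun i => abs_nonneg _) 0
  have h3 : (Pi.single 0 |z 0| : Site 3) = (t : ℤ) • e₁ := by
    ext j
    fin_cases j <;> simp [e₁, hz]
  rw [h3, h1] at h2
  exact h2

/-- Two-point functions from an in-plane point to a far-plane target are dominated by the axis
value: `G(te₁ + q - p) ≤ G(te₁)` for `p₀ = q₀ = 0`. [folklore] -/
theorem criticalTwoPoint_far_inplane_le (t : ℕ) (p q : Site 3) (hp : p 0 = 0) (hq : q 0 = 0) :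
    criticalTwoPoint 3 ((t : ℤ) • e₁ + q - p) ≤ criticalTwoPoint 3 ((t : ℤ) • e₁) :=
  criticalTwoPoint_le_far_axis _ t (by simp [e₁, hp, hq])

/-! ### The two diagonal entries of the Gram minor -/

/-- **The un-pinched pair entry**: `0 ≤ ⟨σ_pσ_q ; σ_{te₁+p}σ_{te₁+q}⟩ ≤ 2 G(te₁)²` for in-plane
`p, q` (GKS II; Lebowitz' inequality bounds the truncation by the two other pairings
`G(te₁)² + G(te₁+q-p) G(te₁+p-q)`, and transverse Messager–Miracle-Solé).
[cite: Lebowitz1974, Theorem, eq. (2.5b)] -/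
theorem pairTrunc_far_le (t : ℕ) (p q : Site 3) (hp : p 0 = 0) (hq : q 0 = 0) :
    0 ≤ pairTrunc p q ((t : ℤ) • e₁ + p) ((t : ℤ) • e₁ + q) ∧
      pairTrunc p q ((t : ℤ) • e₁ + p) ((t : ℤ) • e₁ + q) ≤
        2 * criticalTwoPoint 3 ((t : ℤ) • e₁) ^ 2 := by
  refine ⟨pairPairTruncation_nonneg _ _ _ _, (pairPairTruncation_le_pairings _ _ _ _).trans ?_⟩
  rw [add_sub_cancel_right, add_sub_cancel_right]
  have h3 := criticalTwoPoint_far_inplane_le t p q hp hq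
  have h4 := criticalTwoPoint_far_inplane_le t q p hq hp
  have h6 : 0 ≤ criticalTwoPoint 3 ((t : ℤ) • e₁ + p - q) := criticalTwoPoint_nonneg' _
  have := mul_le_mul h3 h4 h6 (criticalTwoPoint_nonneg' _)
  rw [sq]
  linarith

/-- **The energy entry under GAP**: `⟨σ₀σ_{e₂} ; σ_{te₁}σ_{te₁+e₂}⟩ ≤ max(C,0) t^{-κ} G(te₁)²` for
`t ≥ 1` — `EnergyGapPowerLaw`'s inequality at `x = te₁`, `‖te₁‖ = t`. [folklore] -/
theorem pairTrunc_energy_le_of_gap {κ C : ℝ}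
    (hG : ∀ x : Site 3, x ≠ 0 →
      criticalCorr 3 4 ![0, (Pi.single 1 1 : Site 3), x, x + Pi.single 1 1] -
          criticalCorr 3 2 ![0, (Pi.single 1 1 : Site 3)] * criticalCorr 3 2 ![x, x + Pi.single 1 1] ≤
        C * (‖x‖ : ℝ) ^ (-κ) * criticalTwoPoint 3 x ^ 2)
    (t : ℕ) (ht : 1 ≤ t) :
    pairTrunc 0 e₂ ((t : ℤ) • e₁) ((t : ℤ) • e₁ + e₂) ≤
      max C 0 * (t : ℝ) ^ (-κ) * criticalTwoPoint 3 ((t : ℤ) • e₁) ^ 2 := by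
  have h := hG ((t : ℤ) • e₁) (natSmul_e₁_ne_zero t ht)
  rw [norm_natSmul_e₁] at h
  refine (le_of_eq_of_le rfl h).trans ?_
  gcongr
  exact le_max_left _ _

/-! ### The stub -/

/-- **Stub B — GAP un-pinched at the far end.** `RPSchwarzOnePinch` (the RP Gram minor across every
mirror `θ_t`) and `EnergyGapPowerLaw` (exponent `κ`) give the ONE-PINCH LAW with exponent `κ/2`:
for all `t ≥ 1` and all in-plane targets `p, q` (`p₀ = q₀ = 0`),
`⟨σ₀σ_{e₂} ; σ_{te₁+p}σ_{te₁+q}⟩ ≤ √(2 max(C,0)) · t^{-κ/2} · G(te₁)²`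
(`X² ≤ E·P`, `E ≤ max(C,0) t^{-κ} G²` by GAP, `0 ≤ P ≤ 2G²` by GKS II / Lebowitz / transverse
Messager–Miracle-Solé, then square roots). [cite: FILS1978, Thm. 2.1] -/
theorem stub_gapGivesOnePinchLaw : RPSchwarzOnePinch → EnergyGapPowerLaw → OnePinchLaw := by
  rintro hA ⟨κ, C, hκ, hG⟩
  refine ⟨κ / 2, Real.sqrt (2 * max C 0), by positivity, fun t ht p q hp hq => ?_⟩
  -- (1) the RP Gram minor at `(t, p, q)`: `X² ≤ E · P`
  have hRP := hA t ht p q (by omega) (by omega)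
  rw [axisRefl_inplane t p hp, axisRefl_inplane t q hq] at hRP
  -- (2) the energy entry under GAP, (3)+(4) the un-pinched pair entry
  have hgap := pairTrunc_energy_le_of_gap hG t ht
  obtain ⟨hP0, hP2⟩ := pairTrunc_far_le t p q hp hq
  -- (5) square roots
  set X := pairTrunc 0 e₂ ((t : ℤ) • e₁ + p) ((t : ℤ) • e₁ + q)
  set g := criticalTwoPoint 3 ((t : ℤ) • e₁)
  set B := Real.sqrt (2 * max C 0) * (t : ℝ) ^ (-(κ / 2)) * g ^ 2 with hB
  have ht0 : (0 : ℝ) < (t : ℝ) := by exact_mod_cast ht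
  have hB0 : 0 ≤ B := by positivity
  have key : X ^ 2 ≤ (max C 0 * (t : ℝ) ^ (-κ) * g ^ 2) * (2 * g ^ 2) :=
    hRP.trans (mul_le_mul hgap hP2 hP0 (by positivity))
  have hsq : (max C 0 * (t : ℝ) ^ (-κ) * g ^ 2) * (2 * g ^ 2) = B ^ 2 := by
    have h2' : ((t : ℝ) ^ (-(κ / 2))) ^ 2 = (t : ℝ) ^ (-κ) := by
      rw [← Real.rpow_natCast ((t : ℝ) ^ (-(κ / 2))) 2, ← Real.rpow_mul ht0.le]
      norm_num
    rw [hB, mul_pow, mul_pow, Real.sq_sqrt (by positivity), h2']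
    ring
  calc X ≤ |X| := le_abs_self X
    _ = Real.sqrt (X ^ 2) := (Real.sqrt_sq_eq_abs X).symm
    _ ≤ Real.sqrt (B ^ 2) := Real.sqrt_le_sqrt (key.trans_eq hsq)
    _ = B := Real.sqrt_sq hB0

end Summit.CriticalPhenomena.Ising3DConformalLimit.GapForcesFarMergingRPSchwarz

end
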